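import Mathlib
import Summits.Ventures.PercRepro2.SkeletonSimple

/-!
# The reduction relation of the skeleton moves (blind cell PercRepro2, night-1 g16; NIGHT1-G16.md §2)

The four kernel moves of the skeleton reduction (SkeletonReduction.lean / SkeletonSimple.lean) —
nonzero-loop zeroing, unmarked-leaf zeroing, the series contraction at an unmarked vertex of degree
two, the parallel merge — together with the re-routing of zero-weight edges, packaged as ONE relation
on instances `(p, ends)`:

* **`Step o a₁ a₂ a₃ b I J`** — one move; **`Reduces`** — its reflexive–transitive closure;
* **`isProbVec_of_reduces`** — probability vectors stay probability vectors;
* **`HMF_iff_of_reduces` / `HCov_iff_of_reduces`** — (HMF) and (HCOV) are INVARIANT along the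
  relation (each move is one of the landed invariance theorems);
* **`exists_reduces_simple`** — every instance reduces to a `Simple` one (the strong induction of
  `HCov_of_simple`, now producing the witness); hence **`HMF_of_reduces` / `HCov_of_reduces`**:
  to prove (HMF)/(HCOV) on an instance it suffices to exhibit a reduction to an instance where it is
  known — every class theorem of the S-table is closed under reduction (SkeletonClasses.lean).

Own code; standard axioms.
-/

open scoped Classical

namespace Summit.Ventures.PercRepro2

open UnionCluster CovForm

namespace Skeleton

section Defs

variable {V : Type*} {E : Type*} [DecidableEq E] {R : Type*} [Field R]

/-- **One skeleton move** on instances `(p, ends)` with the marks `o a₁ a₂ a₃ b`: re-routing of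
zero-weight edges, zeroing of a loop, zeroing of the edge of an unmarked leaf, the series contraction
at an unmarked vertex of degree two (`f = {v, w}` re-ended to `{w, w'}` with weight `p f · p f'`,
`f' = {v, w'}` zeroed), and the merge of two parallel edges. -/
inductive Step (o a₁ a₂ a₃ b : V) : (E → R) × (E → Sym2 V) → (E → R) × (E → Sym2 V) → Prop
  | reroute {p : E → R} {ends ends' : E → Sym2 V} (h : ∀ e, p e ≠ 0 → ends e = ends' e) :
      Step o a₁ a₂ a₃ b (p, ends) (p, ends')
  | loop {p : E → R} {ends : E → Sym2 V} {e : E} {x : V} (he : ends e = s(x, x)) :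
      Step o a₁ a₂ a₃ b (p, ends) (Function.update p e 0, ends)
  | leaf {p : E → R} {ends : E → Sym2 V} {f : E} {x y : V} (hf : ends f = s(x, y))
      (hleaf : ∀ e, x ∈ ends e → e = f) (hxy : x ≠ y) (hxo : x ≠ o) (hx1 : x ≠ a₁) (hx2 : x ≠ a₂)
      (hx3 : x ≠ a₃) (hxb : x ≠ b) :
      Step o a₁ a₂ a₃ b (p, ends) (Function.update p f 0, ends)
  | series {p : E → R} {ends : E → Sym2 V} {f f' : E} {v w w' : V} (hff : f ≠ f')
      (hf : ends f = s(v, w)) (hf' : ends f' = s(v, w')) (hdeg : ∀ e, v ∈ ends e → e = f ∨ e = f')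
      (hvw : v ≠ w) (hvw' : v ≠ w') (ho : o ≠ v) (h1 : a₁ ≠ v) (h2 : a₂ ≠ v) (h3 : a₃ ≠ v)
      (hb : b ≠ v) :
      Step o a₁ a₂ a₃ b (p, ends)
        (Function.update (Function.update p f (p f * p f')) f' 0, Function.update ends f s(w, w'))
  | merge {p : E → R} {ends : E → Sym2 V} {e₁ e₂ : E} (hne : e₁ ≠ e₂) (hpar : ends e₁ = ends e₂) :
      Step o a₁ a₂ a₃ b (p, ends)
        (Function.update (Function.update p e₁ (1 - (1 - p e₁) * (1 - p e₂))) e₂ 0, ends)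

/-- **The reduction relation**: finitely many skeleton moves. -/
def Reduces (o a₁ a₂ a₃ b : V) : (E → R) × (E → Sym2 V) → (E → R) × (E → Sym2 V) → Prop :=
  Relation.ReflTransGen (Step o a₁ a₂ a₃ b)

end Defs

section Rel

variable {V : Type*} {E : Type*} [Fintype E] [DecidableEq E] [Fintype V] [DecidableEq V]
  {R : Type*} [Field R] [LinearOrder R] [IsStrictOrderedRing R]

variable {o a₁ a₂ a₃ b : V}

omit [Fintype E] [Fintype V] [DecidableEq V] in
/-- A move keeps probability vectors. -/
theorem isProbVec_of_step {I J : (E → R) × (E → Sym2 V)} (h : Step o a₁ a₂ a₃ b I J)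
    (hp : IsProbVec I.1) : IsProbVec J.1 := by
  cases h with
  | reroute _ => exact hp
  | loop _ => exact hp.update _ le_rfl zero_le_one
  | leaf _ _ _ _ _ _ _ _ => exact hp.update _ le_rfl zero_le_one
  | @series p _ f f' _ _ _ _ _ _ _ _ _ _ _ _ _ _ =>
    exact (hp.update f (mul_nonneg (hp.nonneg f) (hp.nonneg f'))
      (mul_le_one₀ (hp.le_one f) (hp.nonneg f') (hp.le_one f'))).update f' le_rfl zero_le_one
  | @merge p ends e₁ e₂ hne hpar => exact ParallelMerge.isProbVec_merge p ends hne hpar hp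

omit [Fintype E] [Fintype V] [DecidableEq V] in
/-- Along a reduction, probability vectors stay probability vectors. -/
theorem isProbVec_of_reduces {I J : (E → R) × (E → Sym2 V)} (h : Reduces o a₁ a₂ a₃ b I J)
    (hp : IsProbVec I.1) : IsProbVec J.1 := by
  induction h with
  | refl => exact hp
  | tail _ hbc ih => exact isProbVec_of_step hbc ih

/-- **(HMF) is invariant under one move.** -/
theorem HMF_iff_of_step {I J : (E → R) × (E → Sym2 V)} (h : Step o a₁ a₂ a₃ b I J)
    (hp : IsProbVec I.1) : HMF I.1 I.2 o a₁ a₂ a₃ b ↔ HMF J.1 J.2 o a₁ a₂ a₃ b := by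
  cases h with
  | @reroute p _ _ hr =>
    unfold HMF; rw [HMFc_congr_nz p hr o a₁ a₂ a₃ b]
  | @loop p ends _ _ he =>
    unfold HMF; rw [HMFc_update_zero_of_loop p ends he o a₁ a₂ a₃ b]
  | @leaf p _ _ _ _ hf hleaf hxy hxo hx1 hx2 hx3 hxb =>
    unfold HMF; rw [HMFLeafInvisible.HMFc_update_leaf p hf hleaf hxy hxo hx1 hx2 hx3 hxb 0]
  | @series p _ _ _ _ _ _ hff hf hf' hdeg hvw hvw' ho h1 h2 h3 hb =>
    exact SeriesCollapse.HMF_series_contract p hp hff hf hf' hdeg hvw hvw' ho h1 h2 h3 hb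
  | @merge p ends _ _ hne hpar =>
    unfold HMF; rw [ParallelMerge.HMFc_merge p ends hne hpar o a₁ a₂ a₃ b]

omit [Fintype V] [DecidableEq V] in
/-- **(HCOV) is invariant under one move.** -/
theorem HCov_iff_of_step {I J : (E → R) × (E → Sym2 V)} (h : Step o a₁ a₂ a₃ b I J)
    (hp : IsProbVec I.1) : HCov I.1 I.2 o a₁ a₂ a₃ b ↔ HCov J.1 J.2 o a₁ a₂ a₃ b := by
  cases h with
  | @reroute p _ _ hr =>
    unfold HCov; rw [Gc_congr_nz p hr o a₁ a₂ a₃ b]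
  | @loop p ends _ _ he =>
    unfold HCov; rw [Gc_update_zero_of_loop p ends he o a₁ a₂ a₃ b]
  | @leaf p _ _ _ _ hf hleaf hxy hxo hx1 hx2 hx3 hxb =>
    unfold HCov; rw [SeriesCollapse.Gc_update_leaf p hf hleaf hxy hxo hx1 hx2 hx3 hxb 0]
  | @series p _ _ _ _ _ _ hff hf hf' hdeg hvw hvw' ho h1 h2 h3 hb =>
    exact SeriesCollapse.HCov_series_contract p hp hff hf hf' hdeg hvw hvw' ho h1 h2 h3 hb
  | @merge p ends _ _ hne hpar =>
    exact HCov_merge_iff p ends hne hpar o a₁ a₂ a₃ b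

/-- **(HMF) is invariant along every reduction.** -/
theorem HMF_iff_of_reduces {I J : (E → R) × (E → Sym2 V)} (h : Reduces o a₁ a₂ a₃ b I J)
    (hp : IsProbVec I.1) : HMF I.1 I.2 o a₁ a₂ a₃ b ↔ HMF J.1 J.2 o a₁ a₂ a₃ b := by
  induction h with
  | refl => exact Iff.rfl
  | tail hab hbc ih => exact ih.trans (HMF_iff_of_step hbc (isProbVec_of_reduces hab hp))

omit [Fintype V] [DecidableEq V] in
/-- **(HCOV) is invariant along every reduction.** -/
theorem HCov_iff_of_reduces {I J : (E → R) × (E → Sym2 V)} (h : Reduces o a₁ a₂ a₃ b I J)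
    (hp : IsProbVec I.1) : HCov I.1 I.2 o a₁ a₂ a₃ b ↔ HCov J.1 J.2 o a₁ a₂ a₃ b := by
  induction h with
  | refl => exact Iff.rfl
  | tail hab hbc ih => exact ih.trans (HCov_iff_of_step hbc (isProbVec_of_reduces hab hp))

/-- **(HMF) transports back along a reduction**: to prove (HMF) on `I` it suffices to reduce `I` to an
instance on which (HMF) is known. -/
theorem HMF_of_reduces {I J : (E → R) × (E → Sym2 V)} (h : Reduces o a₁ a₂ a₃ b I J)
    (hp : IsProbVec I.1) (hJ : HMF J.1 J.2 o a₁ a₂ a₃ b) : HMF I.1 I.2 o a₁ a₂ a₃ b :=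
  (HMF_iff_of_reduces h hp).2 hJ

omit [Fintype V] [DecidableEq V] in
/-- **(HCOV) transports back along a reduction.** -/
theorem HCov_of_reduces {I J : (E → R) × (E → Sym2 V)} (h : Reduces o a₁ a₂ a₃ b I J)
    (hp : IsProbVec I.1) (hJ : HCov J.1 J.2 o a₁ a₂ a₃ b) : HCov I.1 I.2 o a₁ a₂ a₃ b :=
  (HCov_iff_of_reduces h hp).2 hJ

end Rel

section Witness

variable {V : Type*} {E : Type*} [Fintype E] [DecidableEq E] [Fintype V] [DecidableEq V]
  {R : Type*} [Field R] [LinearOrder R] [IsStrictOrderedRing R]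

omit [DecidableEq V] in
/-- **Every instance reduces to a simple one** (the strong induction of `HCov_of_simple`, with the
reduction path as the witness). -/
theorem exists_reduces_simple (o a₁ a₂ a₃ b : V) (p : E → R) (ends : E → Sym2 V)
    (hp : IsProbVec p) :
    ∃ J : (E → R) × (E → Sym2 V), Reduces o a₁ a₂ a₃ b (p, ends) J ∧
      Simple J.1 J.2 o a₁ a₂ a₃ b := by
  suffices key : ∀ n : ℕ, ∀ (p : E → R) (ends : E → Sym2 V), IsProbVec p → (nz p).card = n →
      ∃ J : (E → R) × (E → Sym2 V), Reduces o a₁ a₂ a₃ b (p, ends) J ∧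
        Simple J.1 J.2 o a₁ a₂ a₃ b from key _ p ends hp rfl
  intro n
  induction n using Nat.strong_induction_on with
  | _ n ih =>
  intro p ends hp hn
  by_cases hpar : ∃ e₁ e₂, p e₁ ≠ 0 ∧ p e₂ ≠ 0 ∧ e₁ ≠ e₂ ∧ ends e₁ = ends e₂
  · -- two parallel nonzero edges: merge them
    obtain ⟨e₁, e₂, h1, h2, hne, hpar⟩ := hpar
    have hmem : e₂ ∈ nz p := mem_nz.2 h2
    have hcard : (nz (Function.update (Function.update p e₁ (1 - (1 - p e₁) * (1 - p e₂))) e₂ 0)).card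
        < n := by
      rw [nz_merge p hne hp h1, Finset.card_erase_of_mem hmem, hn]
      exact Nat.sub_lt (Nat.pos_of_ne_zero (by rw [← hn]; exact Finset.card_ne_zero_of_mem hmem))
        Nat.one_pos
    obtain ⟨J, hJ, hJs⟩ := ih _ hcard _ ends (ParallelMerge.isProbVec_merge p ends hne hpar hp) rfl
    exact ⟨J, Relation.ReflTransGen.head (Step.merge hne hpar) hJ, hJs⟩
  by_cases hloop : ∃ e, p e ≠ 0 ∧ (ends e).IsDiag
  · -- a nonzero loop anywhere: zero it
    obtain ⟨e, hpe, he⟩ := hloop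
    obtain ⟨x, hx⟩ : ∃ x, ends e = s(x, x) := by
      revert he
      generalize ends e = z
      induction z using Sym2.ind with
      | _ y z' => intro hz; exact ⟨y, by rw [Sym2.mk_isDiag_iff.1 hz]⟩
    have hmem : e ∈ nz p := mem_nz.2 hpe
    have hcard : (nz (Function.update p e 0)).card < n := by
      rw [nz_update_zero, Finset.card_erase_of_mem hmem, hn]
      exact Nat.sub_lt (Nat.pos_of_ne_zero (by rw [← hn]; exact Finset.card_ne_zero_of_mem hmem))
        Nat.one_pos
    obtain ⟨J, hJ, hJs⟩ := ih _ hcard (Function.update p e 0) ends (hp.update e le_rfl zero_le_one) rfl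
    exact ⟨J, Relation.ReflTransGen.head (Step.loop hx) hJ, hJs⟩
  · -- no parallel pair, no loop: the reduced case is simple, otherwise leaf / series moves
    have hnopar : ∀ e₁ e₂, p e₁ ≠ 0 → p e₂ ≠ 0 → e₁ ≠ e₂ → ends e₁ ≠ ends e₂ :=
      fun e₁ e₂ h1 h2 hne h => hpar ⟨e₁, e₂, h1, h2, hne, h⟩
    have hnoloopAll : ∀ e, p e ≠ 0 → ¬ (ends e).IsDiag := fun e h1 h => hloop ⟨e, h1, h⟩
    by_cases hred : Reduced p ends o a₁ a₂ a₃ b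
    · exact ⟨(p, ends), Relation.ReflTransGen.refl, hred, hnoloopAll, hnopar⟩
    obtain ⟨v, hvo, hv1, hv2, hv3, hvb, hviol⟩ : ∃ v, v ≠ o ∧ v ≠ a₁ ∧ v ≠ a₂ ∧ v ≠ a₃ ∧ v ≠ b ∧
        ¬ ((∀ e, p e ≠ 0 → ends e ≠ s(v, v)) ∧ (nzDeg p ends v = 0 ∨ 3 ≤ nzDeg p ends v)) := by
      by_contra hcon
      apply hred
      intro v hvo hv1 hv2 hv3 hvb
      by_contra h
      exact hcon ⟨v, hvo, hv1, hv2, hv3, hvb, h⟩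
    have hnoloop : ∀ e, p e ≠ 0 → ends e ≠ s(v, v) := fun e hpe he =>
      hnoloopAll e hpe (by rw [he]; exact Sym2.mk_isDiag_iff.2 rfl)
    have hdeg : nzDeg p ends v = 1 ∨ nzDeg p ends v = 2 := by
      by_contra h
      apply hviol
      refine ⟨hnoloop, ?_⟩
      omega
    set ends' := reroute p ends a₁ with hends'
    have hagree : ∀ e, p e ≠ 0 → ends e = ends' e := fun e he => (reroute_of_ne p ends a₁ he).symm
    have hstep0 : Step o a₁ a₂ a₃ b (p, ends) (p, ends') := Step.reroute hagree
    have hS : (Finset.univ.filter (fun e => v ∈ ends' e)).card = nzDeg p ends v :=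
      card_filter_reroute p ends hv1
    have hnz : ∀ e, v ∈ ends' e → p e ≠ 0 := fun e he => ne_zero_of_mem_reroute p ends hv1 he
    have hnoloop' : ∀ e, v ∈ ends' e → ends' e ≠ s(v, v) := fun e he h =>
      hnoloop e (hnz e he) (by rw [hagree e (hnz e he)]; exact h)
    rcases hdeg with h1 | h2
    · -- nonzero-degree `1`: `v` is a leaf in `ends'`
      rw [← hS, Finset.card_eq_one] at h1
      obtain ⟨f, hf⟩ := h1
      have hvf : v ∈ ends' f := by
        have : f ∈ Finset.univ.filter (fun e => v ∈ ends' e) := by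
          rw [hf]; exact Finset.mem_singleton_self f
        simpa using this
      have hleaf : ∀ e, v ∈ ends' e → e = f := fun e he => by
        have : e ∈ Finset.univ.filter (fun e => v ∈ ends' e) := by simpa using he
        rw [hf] at this
        exact Finset.mem_singleton.1 this
      obtain ⟨y, hy⟩ := Sym2.mem_iff_exists.1 hvf
      have hvy : v ≠ y := fun h => hnoloop' f hvf (by rw [hy, h])
      have hpf : p f ≠ 0 := hnz f hvf
      have hmem : f ∈ nz p := mem_nz.2 hpf
      have hcard : (nz (Function.update p f 0)).card < n := by
        rw [nz_update_zero, Finset.card_erase_of_mem hmem, hn]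
        exact Nat.sub_lt
          (Nat.pos_of_ne_zero (by rw [← hn]; exact Finset.card_ne_zero_of_mem hmem)) Nat.one_pos
      obtain ⟨J, hJ, hJs⟩ :=
        ih _ hcard (Function.update p f 0) ends' (hp.update f le_rfl zero_le_one) rfl
      exact ⟨J, Relation.ReflTransGen.head hstep0
        (Relation.ReflTransGen.head (Step.leaf hy hleaf hvy hvo hv1 hv2 hv3 hvb) hJ), hJs⟩
    · -- nonzero-degree `2`: the series contraction at `v`
      rw [← hS, Finset.card_eq_two] at h2
      obtain ⟨f, f', hff, hS2⟩ := h2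
      have hmemS : ∀ e, v ∈ ends' e ↔ e = f ∨ e = f' := fun e => by
        have : e ∈ Finset.univ.filter (fun e => v ∈ ends' e) ↔ e ∈ ({f, f'} : Finset E) := by
          rw [hS2]
        simpa using this
      have hvf : v ∈ ends' f := (hmemS f).2 (Or.inl rfl)
      have hvf' : v ∈ ends' f' := (hmemS f').2 (Or.inr rfl)
      have hdeg2 : ∀ e, v ∈ ends' e → e = f ∨ e = f' := fun e he => (hmemS e).1 he
      obtain ⟨w, hw⟩ := Sym2.mem_iff_exists.1 hvf
      obtain ⟨w', hw'⟩ := Sym2.mem_iff_exists.1 hvf'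
      have hvw : v ≠ w := fun h => hnoloop' f hvf (by rw [hw, h])
      have hvw' : v ≠ w' := fun h => hnoloop' f' hvf' (by rw [hw', h])
      have hpf' : p f' ≠ 0 := hnz f' hvf'
      have hmem : f' ∈ nz p := mem_nz.2 hpf'
      have hcard : (nz (Function.update (Function.update p f (p f * p f')) f' 0)).card < n := by
        rw [nz_contract p hff hpf', Finset.card_erase_of_mem hmem, hn]
        exact Nat.sub_lt
          (Nat.pos_of_ne_zero (by rw [← hn]; exact Finset.card_ne_zero_of_mem hmem)) Nat.one_pos
      have hp₂ : IsProbVec (Function.update (Function.update p f (p f * p f')) f' 0) :=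
        (hp.update f (mul_nonneg (hp.nonneg f) (hp.nonneg f'))
          (mul_le_one₀ (hp.le_one f) (hp.nonneg f') (hp.le_one f'))).update f' le_rfl zero_le_one
      obtain ⟨J, hJ, hJs⟩ := ih _ hcard _ (Function.update ends' f s(w, w')) hp₂ rfl
      exact ⟨J, Relation.ReflTransGen.head hstep0 (Relation.ReflTransGen.head
        (Step.series hff hw hw' hdeg2 hvw hvw' hvo.symm hv1.symm hv2.symm hv3.symm hvb.symm) hJ),
        hJs⟩

omit [DecidableEq V] in
/-- Every instance reduces to a reduced one. -/
theorem exists_reduces_reduced (o a₁ a₂ a₃ b : V) (p : E → R) (ends : E → Sym2 V)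
    (hp : IsProbVec p) :
    ∃ J : (E → R) × (E → Sym2 V), Reduces o a₁ a₂ a₃ b (p, ends) J ∧
      Reduced J.1 J.2 o a₁ a₂ a₃ b := by
  obtain ⟨J, hJ, hJs⟩ := exists_reduces_simple o a₁ a₂ a₃ b p ends hp
  exact ⟨J, hJ, hJs.1⟩

/-- **The skeleton reduction of (HMF) to simple graphs, re-derived from the relation**: (HMF) on every
simple instance gives (HMF) on every instance. -/
theorem HMF_of_simple' (o a₁ a₂ a₃ b : V)
    (H : ∀ (p : E → R) (ends : E → Sym2 V), IsProbVec p → Simple p ends o a₁ a₂ a₃ b →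
      HMF p ends o a₁ a₂ a₃ b) :
    ∀ (p : E → R) (ends : E → Sym2 V), IsProbVec p → HMF p ends o a₁ a₂ a₃ b := by
  intro p ends hp
  obtain ⟨J, hJ, hJs⟩ := exists_reduces_simple o a₁ a₂ a₃ b p ends hp
  have hpJ : IsProbVec J.1 := isProbVec_of_reduces (I := (p, ends)) hJ hp
  have hHJ : HMF J.1 J.2 o a₁ a₂ a₃ b := H J.1 J.2 hpJ hJs
  exact (HMF_iff_of_reduces (I := (p, ends)) hJ hp).2 hHJ

omit [DecidableEq V] in
/-- The same for (HCOV). -/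
theorem HCov_of_simple' (o a₁ a₂ a₃ b : V)
    (H : ∀ (p : E → R) (ends : E → Sym2 V), IsProbVec p → Simple p ends o a₁ a₂ a₃ b →
      HCov p ends o a₁ a₂ a₃ b) :
    ∀ (p : E → R) (ends : E → Sym2 V), IsProbVec p → HCov p ends o a₁ a₂ a₃ b := by
  intro p ends hp
  obtain ⟨J, hJ, hJs⟩ := exists_reduces_simple o a₁ a₂ a₃ b p ends hp
  have hpJ : IsProbVec J.1 := isProbVec_of_reduces (I := (p, ends)) hJ hp
  have hHJ : HCov J.1 J.2 o a₁ a₂ a₃ b := H J.1 J.2 hpJ hJs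
  exact (HCov_iff_of_reduces (I := (p, ends)) hJ hp).2 hHJ

end Witness

end Skeleton

end Summit.Ventures.PercRepro2
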